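import Literature.MathematicalPhysics.QuantumFieldTheory.Balaban1983to89.Node00.TkNoExpansionStepZero
import Literature.MathematicalPhysics.QuantumFieldTheory.Balaban1983to89.Node00.Record12Numerics
import Literature.MathematicalPhysics.QuantumFieldTheory.Balaban1983to89.Node00.Record12Residuals

/-!
# NODE 00 — THE NO-EXPANSION 𝐓-SLOT AT LEVEL 1 AT THE INHABITANT OF RECORD `θ₀`: the letters' junction `cR·ε₀ ≤ ε₀^{reg}·η₀²` HOLDS at the numerics
# of record (`g₀·log g₀⁻² ≤ 1`), so the background of record at the all-large-field sequence IS the fine field on the regular set; with K0b's residuals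
# the right-hand integrand of N11's first coherence equation is `(#{Y})⁻¹·𝟙{U regular}·exp A_1(s′)(U)`

Cell `pub-ymgap`, YM-PLAN Track A (HUMAN RULING D-0062); author seat `pub-ymgap-dag-n11-d` (g3; R134 fan-out seat N11 [B14], strategy s2), lineage item K1′
`StabilityBAtRecordR12e` = stmt-QuantumFields-19903; the inhabitant of record `θ₀ = theta12OfRecord ζ Rz Zt` is K0a's (`Node00.Record12Numerics`, K0′
`Record12Inhabited` = stmt-QuantumFields-19902), the residuals `ZtOfRecord` K0b's (`Node00.Record12Residuals`).  Sequel of this seat's `Node00.TkNoExpansionStepZero`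
(the level-1 no-expansion slot unfolded; the coherence equation `tLaw₁₂_zero_coherence_of_Omega_empty`; the background resolved under the located numerics junction
`cR·ε₀ ≤ ε₀^{reg}·η₀²`).  [III] = [Balaban1988Convergent].

WHAT THIS FILE PROVES (0 `sorry`, 0 `def`; kernel bookkeeping + one real inequality).  §1 (private helpers `g·log g⁻¹ ≤ e⁻¹` from `log x ≤ x − 1`,
`g·log g⁻² ≤ 1` for `g ≥ 0`), **`lettersJunction_numericsOfRecord₁₂`** ∕ `lettersJunction_theta12OfRecord`: at the displayed numerics of record
(`cR = ε₀^{reg} = A₀ = p₀ = 1`) the junction `cR·ε₀(g₀) ≤ ε₀^{reg}·η₀²` HOLDS for every run with `0 ≤ g₀` — the located junction of file 1 is DISCHARGED at `θ₀`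
(for every choice of the residual arguments).  §2 **`noExpIntegrand_theta12OfRecord_of_chiRegW_ne_zero`** (at `θ₀`, on the support of p. 256's regularity factor, the
§2 operand of the no-expansion integrand reads `exp A_1(s′)(U)` AT THE FINE FIELD — the background of record is `U`, not the junk unit), `ZtOfRecord_ζ0_apply`,
`ZtOfRecord_quad_empty` (K0b's Gaussian placeholder VANISHES at the empty domain: the located factor `e^{−½quad_0(∅)}` is `1` at the inhabitant), and
**`noExpIntegrand_theta12OfRecord_ZtOfRecord`**: with `Zt := ZtOfRecord` the right-hand integrand of the coherence equation is
`(#{Y ⊂ T})⁻¹ · 𝟙{U cR·ε₀-regular} · exp A_1(s′)(U)` (and `0` off the regular set, `…_eq_zero_of_chiRegW_eq_zero`).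

WHAT IT SAYS (a reading for the K0′∕K1′ boards, not a verdict).  At the inhabitant of record with K0b's residuals, (S1ᵀ)_0's identity branch at the all-large-field
sequence asks `∫dU δ(ŪV₁⁻¹) w(s′)(U,V₁)·ρ₀(U) = (#{Y})⁻¹·∫dU δ(ŪV₁⁻¹) 𝟙{U regular}·e^{A_1(s′)(U)}` for `dV₁`-a.e. `V₁` (file 1), with the left side carrying def-T's
(3.2) large-field indicators of `V₁` (the step weights of the all-large-field label set) and the right side NO `V₁`-dependence beyond the fibre — dag-n11-d g2's
reading (ii) (pub-ymgap INBOX l.14524) in kernel form.  Whether the two transports can agree is NOT decided here (no positivity-of-measure facts about the (3.2)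
regions in the tree; the zero branch `slotT_1(s′) ≡ 0` is not excluded either): the file pins the equation, the K1′ witness's `Zt` is what must satisfy it.

HONEST SCOPE.  Count-neutral; nothing of Bałaban asserted; N11 NOT discharged (typed 28∕28 · discharged 5∕28); one finite four-torus programme at fixed
`ε = L^{−K}`; NOT ℝ⁴ ∕ OS ∕ mass gap ∕ Clay.  Sources: [III] (2.4) p. 255, (2.10)–(2.12) p. 256, (2.18) p. 257, (2.21)–(2.23) p. 258, (3.1)–(3.2) pp. 264–265,
(3.25) p. 270, Theorem p. 245; [Balaban1987RG1] (1.5) p. 261.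
-/

noncomputable section

open MeasureTheory
open scoped Matrix.Norms.L2Operator

namespace Literature.MathematicalPhysics.QuantumFieldTheory.Balaban1983to89.Node00

open T4AveragingDisintegration T4Continuum T4FiniteEpsInhabited Tk B14.Eq218Concrete

/-! ## §1  The letters' junction `cR·ε₀ ≤ ε₀^{reg}·η₀²` at the numerics of record: `g·log(g⁻²) ≤ 1` -/

/-- `g·log(1∕g) ≤ 1∕e` for `g > 0` (from `log x ≤ x − 1` at `x = 1∕(e·g)`). [folklore] -/
private theorem mul_log_inv_le_inv_exp_one {g : ℝ} (hg : 0 < g) : g * Real.log g⁻¹ ≤ (Real.exp 1)⁻¹ := by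
  have he : 0 < Real.exp 1 := Real.exp_pos 1
  have hx : 0 < (Real.exp 1 * g)⁻¹ := inv_pos.mpr (mul_pos he hg)
  have h1 : Real.log (Real.exp 1 * g)⁻¹ ≤ (Real.exp 1 * g)⁻¹ - 1 := Real.log_le_sub_one_of_pos hx
  have h2 : Real.log (Real.exp 1 * g)⁻¹ = Real.log g⁻¹ - 1 := by
    rw [mul_inv, Real.log_mul (inv_ne_zero he.ne') (inv_ne_zero hg.ne'), Real.log_inv (Real.exp 1), Real.log_exp]
    ring
  have h3 : Real.log g⁻¹ ≤ (Real.exp 1 * g)⁻¹ := by linarith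
  calc g * Real.log g⁻¹ ≤ g * (Real.exp 1 * g)⁻¹ := mul_le_mul_of_nonneg_left h3 hg.le
    _ = (Real.exp 1)⁻¹ := by field_simp

/-- **`g·log(g⁻²) ≤ 1` for `g ≥ 0`** (`= 2g·log(1∕g) ≤ 2∕e < 1` for `g > 0`; `0` at `g = 0`). [folklore] -/
private theorem mul_log_inv_sq_le_one {g : ℝ} (hg : 0 ≤ g) : g * Real.log (g ^ 2)⁻¹ ≤ 1 := by
  rcases hg.eq_or_lt with rfl | hg'
  · simp
  · have h2 : Real.log (g ^ 2)⁻¹ = 2 * Real.log g⁻¹ := by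
      rw [← inv_pow, Real.log_pow]
      norm_num
    rw [h2, mul_left_comm]
    have he : (Real.exp 1)⁻¹ < 1 / 2 := by
      rw [inv_lt_comm₀ (Real.exp_pos 1) (by norm_num : (0 : ℝ) < 1 / 2)]
      have := Real.exp_one_gt_d9
      norm_num at this ⊢
      linarith
    have := mul_log_inv_le_inv_exp_one hg'
    linarith

variable (F : T4Family) (N : ℕ) [NeZero N]

/-- **THE LETTERS' JUNCTION HOLDS AT THE NUMERICS OF RECORD**: with `cR = ε₀^{reg} = A₀ = p₀ = 1` (12b∕K0a's displayed defaults) and any nonnegative bare coupling,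
`cR·ε₀(g₀) = g₀·log(g₀⁻²) ≤ 1 = ε₀^{reg}·η₀²` — so on the support of p. 256's regularity factor the fine field lies in print's (2.12) class (file 1's
`plaqSmall_of_chiRegW_zero_univ_ne_zero`). [cite: Balaban1988Convergent, (2.4) p.255, (2.10) p.256, (2.12) p.256] -/
theorem lettersJunction_numericsOfRecord₁₂ (K : ℕ) (g : ℕ → ℝ) (hg : 0 ≤ g 0) :
    sect2NumericsOfRecord₁₂.cR * epsOfRecord numerics7OfRecord₁₂ g 0 ≤ numerics7OfRecord₁₂.εreg * (F.P K).eta 0 ^ 2 := by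
  show (1 : ℝ) * (g 0 * ((1 : ℝ) * (Real.log (g 0 ^ 2)⁻¹) ^ (1 : ℕ))) ≤ 1 * (((F.P K).L : ℝ)⁻¹ ^ 0) ^ 2
  simp only [one_mul, pow_one, pow_zero, one_pow]
  exact mul_log_inv_sq_le_one hg

variable {F N}

/-- **… AT `θ₀ = theta12OfRecord`** (any residual arguments), along every run with a nonnegative bare coupling `g₀` (`g_0 = g₀`: `genSeq_zero`).
[cite: Balaban1988Convergent, (2.4) p.255, (2.10) p.256, (2.12) p.256] -/
theorem lettersJunction_theta12OfRecord (ζ : ZetaOfRecord F N numerics7OfRecord₁₂ 1) (Rz : (K : ℕ) → Sect2.Residual (F.P K) (MatA N))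
    (Zt : (K : ℕ) → TkResidualW F N (FluctV N) K) (p : B12.RunParams) (hg : 0 ≤ p.g0) :
    (theta12OfRecord F N ζ Rz Zt).s2.cR * epsOfRecord (theta12OfRecord F N ζ Rz Zt).ν
        (gOfRecord₁₀ F N (theta12OfRecord F N ζ Rz Zt).toStage9Params p) 0 ≤
      (theta12OfRecord F N ζ Rz Zt).ν.εreg * (F.P p.K).eta 0 ^ 2 := by
  have h0 : gOfRecord₁₀ F N (theta12OfRecord F N ζ Rz Zt).toStage9Params p 0 = p.g0 := FlowStepRuns.genSeq_zero _ _
  exact lettersJunction_numericsOfRecord₁₂ F p.K (gOfRecord₁₀ F N (theta12OfRecord F N ζ Rz Zt).toStage9Params p) (by rw [h0]; exact hg)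


/-! ## §2  The no-expansion integrand at the inhabitant of record `θ₀`: the background IS the fine field on the regular set; with K0b's residuals the integrand is
`(#{Y})⁻¹ · 𝟙{U regular} · exp A_1(s′)(U)` -/

section AtTheta

variable (ζ : ZetaOfRecord F N numerics7OfRecord₁₂ 1) (Rz : (K : ℕ) → Sect2.Residual (F.P K) (MatA N)) (Zt : (K : ℕ) → TkResidualW F N (FluctV N) K)

/-- **AT `θ₀` (ANY residual arguments) THE RIGHT-HAND INTEGRAND OF THE COHERENCE EQUATION READS THE ACTION AT THE FINE FIELD**: on the support of p. 256's
regularity factor (runs with `0 ≤ g₀`), `noExpIntegrand = ζ0_0(T)·χreg_0(T)·e^{−½quad_0(∅)}·exp A_1(s′)(U)` at `(U, V₁)` — file 1's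
`noExpIntegrand_WtOfRecord₁₂_sect2Operand_of_chiRegW_ne_zero` with the letters' junction DISCHARGED at the numerics of record.
[cite: Balaban1988Convergent, (2.10) p.256, (2.12) p.256, (2.18) p.257, (2.21)–(2.23) p.258, Thm 1 p.262] -/
theorem noExpIntegrand_theta12OfRecord_of_chiRegW_ne_zero (p : B12.RunParams) (hg : 0 ≤ p.g0)
    (s : SeqOfRecord F (theta12OfRecord F N ζ Rz Zt).ν (theta12OfRecord F N ζ Rz Zt).τ9.M
      (gOfRecord₁₀ F N (theta12OfRecord F N ζ Rz Zt).toStage9Params p) p.K 1) (hΩ : s.Ω 1 = ∅)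
    (t : Sect2.TermValues (F.P p.K) (MatA N) (FluctV N) (theta12OfRecord F N ζ Rz Zt).τ9.M) (Ek : ℝ) (V1 : GaugeField (F.P p.K) 1 (SU N))
    (Uf : GaugeField (F.P p.K) 0 (SU N))
    (h : chiRegW F N (FluctV N) (theta12OfRecord F N ζ Rz Zt).ν (theta12OfRecord F N ζ Rz Zt).s2.cR p
      (gOfRecord₁₀ F N (theta12OfRecord F N ζ Rz Zt).toStage9Params p) 0 Set.univ (pairCfg (V := FluctV N) V1 Uf) ≠ 0) :
    noExpIntegrand F N (FluctV N) p.K (WtOfRecord₁₂ F N (theta12OfRecord F N ζ Rz Zt) p)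
        (sect2Operand F N (FluctV N) p.K (settingOfRecord₁₂ F N (theta12OfRecord F N ζ Rz Zt) p) ((theta12OfRecord F N ζ Rz Zt).Rz p.K) s t Ek
          (UbgOfRecord₁₂ F N (theta12OfRecord F N ζ Rz Zt) p 1 s)) V1 Uf =
      (Zt p.K).ζ0 0 Set.univ (pairCfg V1 Uf) *
          chiRegW F N (FluctV N) (theta12OfRecord F N ζ Rz Zt).ν (theta12OfRecord F N ζ Rz Zt).s2.cR p
            (gOfRecord₁₀ F N (theta12OfRecord F N ζ Rz Zt).toStage9Params p) 0 Set.univ (pairCfg V1 Uf) *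
        (Real.exp (-(1 / 2 : ℝ) * (Zt p.K).quad 0 ∅ (pairCfg V1 Uf)) *
          Real.exp ((sect2ActionDataOfRecord F N (FluctV N) p.K (settingOfRecord₁₂ F N (theta12OfRecord F N ζ Rz Zt) p)
            ((theta12OfRecord F N ζ Rz Zt).Rz p.K) s t (fun _ => ∅, fun j => (pairCfg (V := FluctV N) V1 Uf j).2) Ek).action23 1 Uf)) :=
  noExpIntegrand_WtOfRecord₁₂_sect2Operand_of_chiRegW_ne_zero (theta12OfRecord F N ζ Rz Zt) p (lettersJunction_theta12OfRecord ζ Rz Zt p hg)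
    s hΩ t Ek V1 Uf h

omit [NeZero N] in
/-- K0b's residual factor of record is the uniform constant `(#{Y ⊂ T})⁻¹` (`rfl`). [cite: Balaban1988Convergent, p.267 (bookkeeping witness)] -/
theorem ZtOfRecord_ζ0_apply (K j : ℕ) (Y : Set (Site (F.P K) 0)) (ω : MultiCfg (F.P K) (SU N) (FluctV N)) :
    (ZtOfRecord F N K).ζ0 j Y ω = ((Nat.card (Set (Site (F.P K) 0)) : ℝ))⁻¹ := rfl

omit [NeZero N] in
/-- K0b's unit-covariance placeholder VANISHES AT THE EMPTY DOMAIN (no bond has both ends in `∅`): the located factor `e^{−½quad_j(∅)}` of file 1's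
`w_tkWeightsOfRecord_empty` is `1` at the inhabitant of record. [cite: Balaban1987RG1, (1.5) p.261 (bookkeeping witness)] -/
theorem ZtOfRecord_quad_empty (K j : ℕ) (ω : MultiCfg (F.P K) (SU N) (FluctV N)) : (ZtOfRecord F N K).quad j ∅ ω = 0 := by
  show quadUnitOfRecord F N K j ∅ ω = 0
  unfold quadUnitOfRecord
  refine Finset.sum_eq_zero fun b hb => ?_
  simp [B15DeterminingSets.pts] at hb

/-- **AT THE INHABITANT OF RECORD WITH K0b's RESIDUALS (`Zt := ZtOfRecord`) THE NO-EXPANSION INTEGRAND IS `(#{Y})⁻¹ · 𝟙{U cR·ε₀-regular} · exp A_1(s′)(U)`**: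
the residual factor is a constant, the Gaussian placeholder is `1` at `∅`, the background is the fine field — so (S1ᵀ)_0's identity branch at the all-large-field
sequence asks, `dV₁`-a.e., `∫dU δ(ŪV₁⁻¹) w(s′)(U,V₁)·ρ₀(U) = (#{Y})⁻¹ ∫dU δ(ŪV₁⁻¹) 𝟙{U regular}·e^{A_1(s′)(U)}` (file 1's `tLaw₁₂_zero_coherence_of_Omega_empty`;
the left side carries def-T's (3.2) large-field indicators of `V₁`, the right side none — dag-n11-d g2's reading (ii) of pub-ymgap INBOX l.14524, now explicit).
[cite: Balaban1988Convergent, (2.10) p.256, (2.18) p.257, (2.21)–(2.23) p.258, (3.1)–(3.2) pp.264–265, (3.25) p.270, Theorem p.245] -/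
theorem noExpIntegrand_theta12OfRecord_ZtOfRecord (p : B12.RunParams) (hg : 0 ≤ p.g0)
    (s : SeqOfRecord F (theta12OfRecord F N ζ Rz (ZtOfRecord F N)).ν (theta12OfRecord F N ζ Rz (ZtOfRecord F N)).τ9.M
      (gOfRecord₁₀ F N (theta12OfRecord F N ζ Rz (ZtOfRecord F N)).toStage9Params p) p.K 1) (hΩ : s.Ω 1 = ∅)
    (t : Sect2.TermValues (F.P p.K) (MatA N) (FluctV N) (theta12OfRecord F N ζ Rz (ZtOfRecord F N)).τ9.M) (Ek : ℝ)
    (V1 : GaugeField (F.P p.K) 1 (SU N)) (Uf : GaugeField (F.P p.K) 0 (SU N))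
    (h : chiRegW F N (FluctV N) (theta12OfRecord F N ζ Rz (ZtOfRecord F N)).ν (theta12OfRecord F N ζ Rz (ZtOfRecord F N)).s2.cR p
      (gOfRecord₁₀ F N (theta12OfRecord F N ζ Rz (ZtOfRecord F N)).toStage9Params p) 0 Set.univ (pairCfg (V := FluctV N) V1 Uf) ≠ 0) :
    noExpIntegrand F N (FluctV N) p.K (WtOfRecord₁₂ F N (theta12OfRecord F N ζ Rz (ZtOfRecord F N)) p)
        (sect2Operand F N (FluctV N) p.K (settingOfRecord₁₂ F N (theta12OfRecord F N ζ Rz (ZtOfRecord F N)) p)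
          ((theta12OfRecord F N ζ Rz (ZtOfRecord F N)).Rz p.K) s t Ek (UbgOfRecord₁₂ F N (theta12OfRecord F N ζ Rz (ZtOfRecord F N)) p 1 s)) V1 Uf =
      ((Nat.card (Set (Site (F.P p.K) 0)) : ℝ))⁻¹ *
        Real.exp ((sect2ActionDataOfRecord F N (FluctV N) p.K (settingOfRecord₁₂ F N (theta12OfRecord F N ζ Rz (ZtOfRecord F N)) p)
          ((theta12OfRecord F N ζ Rz (ZtOfRecord F N)).Rz p.K) s t (fun _ => ∅, fun j => (pairCfg (V := FluctV N) V1 Uf j).2) Ek).action23 1 Uf) := by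
  have h1 := (chiRegW_ne_zero_iff (V := FluctV N) Set.univ _).1 h
  have hreg : chiRegW F N (FluctV N) (theta12OfRecord F N ζ Rz (ZtOfRecord F N)).ν (theta12OfRecord F N ζ Rz (ZtOfRecord F N)).s2.cR p
      (gOfRecord₁₀ F N (theta12OfRecord F N ζ Rz (ZtOfRecord F N)).toStage9Params p) 0 Set.univ (pairCfg (V := FluctV N) V1 Uf) = 1 := by
    unfold chiRegW
    rw [if_pos h1]
  rw [noExpIntegrand_theta12OfRecord_of_chiRegW_ne_zero ζ Rz (ZtOfRecord F N) p hg s hΩ t Ek V1 Uf h, ZtOfRecord_ζ0_apply, ZtOfRecord_quad_empty,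
    mul_zero, Real.exp_zero, one_mul, hreg, mul_one]

/-- … and OFF the regular set it VANISHES (file 1). [cite: Balaban1988Convergent, (2.10) p.256 (bookkeeping)] -/
theorem noExpIntegrand_theta12OfRecord_eq_zero_of_chiRegW_eq_zero (p : B12.RunParams)
    (Φ : SFluct (F.P p.K) (FluctV N) → B15DeterminingSets.MSField (F.P p.K) (SU N) → ℝ) (V1 : GaugeField (F.P p.K) 1 (SU N))
    (Uf : GaugeField (F.P p.K) 0 (SU N))
    (h : chiRegW F N (FluctV N) (theta12OfRecord F N ζ Rz Zt).ν (theta12OfRecord F N ζ Rz Zt).s2.cR p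
      (gOfRecord₁₀ F N (theta12OfRecord F N ζ Rz Zt).toStage9Params p) 0 Set.univ (pairCfg (V := FluctV N) V1 Uf) = 0) :
    noExpIntegrand F N (FluctV N) p.K (WtOfRecord₁₂ F N (theta12OfRecord F N ζ Rz Zt) p) Φ V1 Uf = 0 :=
  noExpIntegrand_WtOfRecord₁₂_eq_zero_of_chiRegW_eq_zero (theta12OfRecord F N ζ Rz Zt) p Φ V1 Uf h

end AtTheta

end Literature.MathematicalPhysics.QuantumFieldTheory.Balaban1983to89.Node00

end
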